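import Summits.RiemannHypothesis.RiemannHypothesis.Theorems.HandoffInteraction
import HarnessLib

/-!
# HANDOFF — the interaction hierarchy, part 2: the SHARP one-place cap at deep lags (`a < log p`) (cell rh-explicit, TRACK «HANDOFF», seat theory-2 gen5)

HONEST FRAMING. Nothing here bears on the truth of RH; RH-free bookkeeping continuing `HandoffInteraction.lean` (file XII-f). There the
one-place sandwich `|λ_min(S ∪ {p}; a; P) − λ_min(S; a; P)| ≤ placeCap(p, a) = 2 Σ_{p^m ≤ e^{2a}} (log p) p^{−m/2}` carries the crude factor
`2` of `|k(x) + k(−x)| ≤ 2‖g‖₂²`. When the lag exceeds the half-width of the window — `a < log p`, so every visible power `p^m` has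
`m log p > a` — the sliver bound `|k(x) + k(−x)| ≤ ‖g‖₂²` (`norm_weilConv_weilReflect_add_neg_le`, Bombieri's §4 Lemma 2 sharpened on a
sliver, the constant of `HandoffEdgeLayer`'s cap) HALVES it:

* §7 `abs_semilocalGroundEnergy_insert_sub_le_half`: **`|λ_min(S ∪ {p}; a; P) − λ_min(S; a; P)| ≤ placeCap(p, a)/2`** for `a < log p`, every
  finite `S`, sector `P`; the cumulant forms `abs_semilocalCumulant_singleton_le_half` (|Δ_p| ≤ placeCap/2), `abs_semilocalCumulant_le_half`
  (`|J_T| ≤ 2^{|T|−1}·placeCap(p, a)/2` for `p ∈ T`, `a < log p` — e.g. the largest prime of `T` in every cell of SEMILOCAL-TABLE §2e with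
  `max T ≥ 5`), the sharp relay `abs_semilocalGroundEnergy_union_sub_le_half`, and the handoff window in EVERY sector:
  `abs_semilocalCumulant_handoff_le_cap_sector` — `|G_q(b; P)| ≤ (log q)/√q = cap(q)` for `b ≤ (log q')/2` (the sector form of
  `HandoffLoadCeiling`'s sandwich; `0` below `(log q)/2`).
DERIVED-CHECK against SEMILOCAL-TABLE §2 (free odd, CERTIFIED cc6 cells; arithmetic only, not blind): `Δ_5(1.19) = 0.6147 ≤ (log 5)/√5 = 0.7198`
(85 % of the sharp cap), `Δ_3(0.83) = 0.4904 ≤ (log 3)/√3 = 0.6343` (77 %), `Δ_3(0.90) = 0.4606` (73 %), `Δ_5(1.40) = 0.4690` (65 %): a place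
past its entry realises 65–85 % of its maximal RH-free effect on the free-odd bottom — the per-place form of the load saturation
`r(q) = 0.76 … 0.97` of HANDOFF-STATEMENT §D.5 (a reading, not a claim).

References (as printed): E. Bombieri, Rend. Mat. Acc. Lincei (9) 11 (2000) §4 Lemma 2 (`|f * g*| ≤ ‖f‖‖g‖`), Lemma 3 [`Bombieri2000Weil`];
A. Connes, C. Consani, Enseign. Math. 69 (2023) = arXiv:2106.01715, §2.1 (`W_p`), §2.2–2.4 [`ConnesConsani2023`].
-/

set_option linter.dupNamespace false  -- the mandated namespace repeats `RiemannHypothesis`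

noncomputable section
open Set Complex MeasureTheory Literature.NumberTheory.LFunctions
open Summit.RiemannHypothesis.RiemannHypothesis.Theorems.Handoff
open Summit.RiemannHypothesis.RiemannHypothesis.Theorems.HandoffAnalytic
open Summit.RiemannHypothesis.RiemannHypothesis.Theorems.HandoffSemilocalEnergy
open Summit.RiemannHypothesis.RiemannHypothesis.Theorems.HandoffLoadCeiling
open Summit.RiemannHypothesis.RiemannHypothesis.Theorems.MotivicDoor.SemilocalThreshold
open Summit.RiemannHypothesis.RiemannHypothesis.Theorems.MotivicDoor.Semilocal
open scoped Real ComplexConjugate ArithmeticFunction.vonMangoldt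

namespace Summit.RiemannHypothesis.RiemannHypothesis.Theorems.HandoffInteraction

variable {g : ℝ → ℂ} {S T U B : Finset ℕ} {P : (ℝ → ℂ) → Prop} {a : ℝ} {p q q' N : ℕ}

/-! ## §7  The SHARP one-place cap at deep lags: half the place cap when `a < log p` -/

/-- **Place term against a PAIR bound.** If `‖k(log n) + k(−log n)‖ ≤ M₁` for every `n ≥ p` (only the powers `n = p^m ≥ p` carry a
non-zero `{p}`-coefficient), then `‖W_{{p}}(k)‖ ≤ (placeCap(p, a)/2)·M₁` for a continuous `k` with `tsupport k ⊆ [−2a, 2a]`.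
[cite: Bombieri2000Weil, §4 Lemma 3 (finite prime sum on a window), for the single place p] -/
theorem norm_weilSemilocalPrimeTerm_singleton_le_of_pair (p : ℕ) {k : ℝ → ℂ} (hk : Continuous k) {M₁ : ℝ}
    (hsupp : tsupport k ⊆ Icc (-(2 * a)) (2 * a))
    (hM : ∀ n : ℕ, p ≤ n → ‖k (Real.log n) + k (-Real.log n)‖ ≤ M₁) :
    ‖weilSemilocalPrimeTerm {p} k‖ ≤ placeCap p a / 2 * M₁ := by
  set N : ℕ := ⌊Real.exp (2 * a)⌋₊ with hN
  have hb : 2 * a ≤ Real.log ((N : ℝ) + 1) := by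
    have h1 : Real.exp (2 * a) < (N : ℝ) + 1 := by rw [hN]; exact Nat.lt_floor_add_one _
    have := Real.log_le_log (Real.exp_pos _) h1.le
    rwa [Real.log_exp] at this
  have hsupp' : tsupport k ⊆ Icc (-Real.log ((N : ℝ) + 1)) (Real.log ((N : ℝ) + 1)) :=
    hsupp.trans (Icc_subset_Icc (neg_le_neg hb) hb)
  rw [weilSemilocalPrimeTerm_eq_sum_of_tsupport_subset {p} hk N hsupp']
  calc ‖∑ n ∈ Finset.range (N + 1), (weilSemilocalCoeff {p} n : ℂ) * (k (Real.log n) + k (-Real.log n))‖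
      ≤ ∑ n ∈ Finset.range (N + 1), weilSemilocalCoeff {p} n * M₁ := by
        refine norm_sum_le_of_le _ fun n _ ↦ ?_
        rw [norm_mul, Complex.norm_real, Real.norm_of_nonneg (weilSemilocalCoeff_nonneg _ _)]
        by_cases hnp : p ≤ n
        · exact mul_le_mul_of_nonneg_left (hM n hnp) (weilSemilocalCoeff_nonneg _ _)
        · rw [weilSemilocalCoeff_eq_zero_of_lt_of_forall_le (S := {p}) (P := p)
            (fun q hq ↦ (Finset.mem_singleton.1 hq).ge) (not_le.1 hnp), zero_mul, zero_mul]
    _ = placeCap p a / 2 * M₁ := by rw [← Finset.sum_mul, placeCap]; ring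

/-- **Pointwise SHARP one-place sandwich at deep lags**: for a prime `p` with `a < log p` (the lag `log p` exceeds the half-width of
the window, so `|k(m log p) + k(−m log p)| ≤ ‖g‖₂²` by the sliver bound) and `g ∈ C(a)`:
`|Re Q_{S ∪ {p}}(g) − Re Q_S(g)| ≤ (placeCap(p, a)/2)·‖g‖₂²` — on the handoff window this is `HandoffEdgeLayer`'s sharp `cap(q)‖g‖₂²`.
[cite: Bombieri2000Weil, §4 Lemma 2 (sharpened on a sliver: this track, `HandoffEdgeLayer`)] -/
theorem abs_re_weilSemilocalQuadratic_insert_sub_le_half (hp : p.Prime) (ha : a < Real.log p) (S : Finset ℕ)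
    (hg : IsWeilTest g) (hsupp : tsupport g ⊆ Icc (-a) a) :
    |(weilSemilocalQuadratic (insert p S) g).re - (weilSemilocalQuadratic S g).re| ≤
      placeCap p a / 2 * ∫ t, ‖g t‖ ^ 2 := by
  by_cases hpS : p ∈ S
  · rw [Finset.insert_eq_of_mem hpS, sub_self, abs_zero]
    exact mul_nonneg (div_nonneg (placeCap_nonneg p a) zero_le_two) (integral_nonneg fun _ ↦ by positivity)
  · have hk : IsWeilTest (weilConv g (weilReflect g)) := hg.weilConv hg.weilReflect
    have hpair : ∀ n : ℕ, p ≤ n → ‖weilConv g (weilReflect g) (Real.log n) +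
        weilConv g (weilReflect g) (-Real.log n)‖ ≤ ∫ t, ‖g t‖ ^ 2 := by
      intro n hn
      refine norm_weilConv_weilReflect_add_neg_le hg hsupp (ha.trans_le ?_)
      exact Real.log_le_log (by exact_mod_cast hp.pos) (by exact_mod_cast hn)
    have h := norm_weilSemilocalPrimeTerm_singleton_le_of_pair p hk.1.continuous
      (tsupport_weilConv_weilReflect_subset hg.2 hsupp) hpair
    rw [re_weilSemilocalQuadratic_insert hp hpS hg, sub_sub_cancel_left, abs_neg]
    exact (Complex.abs_re_le_norm _).trans h

/-- **SHARP ONE-PLACE SANDWICH (RH-free)**: `|λ_min(S ∪ {p}; a; P) − λ_min(S; a; P)| ≤ placeCap(p, a)/2 = Σ_{p^m ≤ e^{2a}} (log p) p^{−m/2}`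
for every finite `S`, sector `P` and prime `p` with `a < log p` — inserting a place whose first lag exceeds the half-width moves the
bottom by at most the visible weight itself (not twice it). DATA (SEMILOCAL-TABLE §2, free odd): `Δ_5(1.19) = 0.6147 ≤ (log 5)/√5 = 0.7198`
(85 % of the cap), `Δ_3(0.83) = 0.4904 ≤ (log 3)/√3 = 0.6343` (77 %). [cite: ConnesConsani2023, §2.2–2.4 (smallest eigenvalue with and without the prime); bound: this track] -/
theorem abs_semilocalGroundEnergy_insert_sub_le_half (hp : p.Prime) (ha : a < Real.log p) (S : Finset ℕ)
    (P : (ℝ → ℂ) → Prop) :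
    |semilocalGroundEnergy (insert p S) P a - semilocalGroundEnergy S P a| ≤ placeCap p a / 2 := by
  rcases (semilocalSphereValues S P a).eq_empty_or_nonempty with he | hne
  · have he' : semilocalSphereValues (insert p S) P a = ∅ := (semilocalSphereValues_eq_empty_iff _ S P a).2 he
    rw [semilocalGroundEnergy, semilocalGroundEnergy, he, he', Real.sInf_empty, sub_self, abs_zero]
    exact div_nonneg (placeCap_nonneg p a) zero_le_two
  · have hne' : (semilocalSphereValues (insert p S) P a).Nonempty :=
      (semilocalSphereValues_nonempty_iff _ P a).2 ((semilocalSphereValues_nonempty_iff S P a).1 hne)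
    have hlo : semilocalGroundEnergy S P a - placeCap p a / 2 ≤ semilocalGroundEnergy (insert p S) P a := by
      refine le_semilocalGroundEnergy hne' fun g hg hs hP hn ↦ ?_
      have h1 := abs_re_weilSemilocalQuadratic_insert_sub_le_half hp ha S hg hs
      rw [hn, mul_one] at h1
      have h2 := semilocalGroundEnergy_le_re (S := S) hg hs hP hn
      linarith [(abs_le.1 h1).1]
    have hhi : semilocalGroundEnergy (insert p S) P a - placeCap p a / 2 ≤ semilocalGroundEnergy S P a := by
      refine le_semilocalGroundEnergy hne fun g hg hs hP hn ↦ ?_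
      have h1 := abs_re_weilSemilocalQuadratic_insert_sub_le_half hp ha S hg hs
      rw [hn, mul_one] at h1
      have h2 := semilocalGroundEnergy_le_re (S := insert p S) hg hs hP hn
      linarith [(abs_le.1 h1).2]
    exact abs_le.2 ⟨by linarith, by linarith⟩

/-- Hence the sharp increment bound in cumulant language: `|J^B_{{p}}(a; P)| = |Δ_p| ≤ placeCap(p, a)/2` for `a < log p`. [folklore] -/
theorem abs_semilocalCumulant_singleton_le_half (hp : p.Prime) (ha : a < Real.log p) (B : Finset ℕ)
    (P : (ℝ → ℂ) → Prop) : |semilocalCumulant B {p} P a| ≤ placeCap p a / 2 := by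
  rw [semilocalCumulant_singleton]
  exact abs_semilocalGroundEnergy_insert_sub_le_half hp ha B P

/-- **Sharp cumulant bound**: `|J^B_T(a; P)| ≤ 2^{|T|−1}·placeCap(p, a)/2` for every `p ∈ T` with `a < log p` (e.g. the LARGEST prime
of `T` in every cell of SEMILOCAL-TABLE §2e with `max T ≥ 5`). [folklore] -/
theorem abs_semilocalCumulant_le_half (hp : p.Prime) (hpT : p ∈ T) (ha : a < Real.log p) (B : Finset ℕ)
    (P : (ℝ → ℂ) → Prop) : |semilocalCumulant B T P a| ≤ 2 ^ (T.card - 1) * (placeCap p a / 2) := by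
  have hT : T = insert p (T.erase p) := (Finset.insert_erase hpT).symm
  have hcard : T.card - 1 = (T.erase p).card := by rw [Finset.card_erase_of_mem hpT]
  rw [hcard, hT, semilocalCumulant_insert (Finset.notMem_erase p T), Finset.erase_insert_eq_erase,
    Finset.erase_eq_of_notMem (Finset.notMem_erase p T)]
  refine (Finset.abs_sum_le_sum_abs _ _).trans
    ((Finset.sum_le_sum (g := fun _ ↦ placeCap p a / 2) fun R _ ↦ ?_).trans_eq ?_)
  · rw [abs_mul, abs_pow, abs_neg, abs_one, one_pow, one_mul, Finset.union_insert]
    exact abs_semilocalGroundEnergy_insert_sub_le_half hp ha _ P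
  · rw [Finset.sum_const, Finset.card_powerset, nsmul_eq_mul]
    push_cast
    ring

/-- **Sharp relay defect**: `|λ_min(S ∪ U; a; P) − λ_min(S; a; P)| ≤ Σ_{p ∈ U} placeCap(p, a)/2` when every `p ∈ U` is a prime with
`a < log p`. [folklore] -/
theorem abs_semilocalGroundEnergy_union_sub_le_half (hU : ∀ p ∈ U, p.Prime ∧ a < Real.log p) (S : Finset ℕ)
    (P : (ℝ → ℂ) → Prop) :
    |semilocalGroundEnergy (S ∪ U) P a - semilocalGroundEnergy S P a| ≤ ∑ p ∈ U, placeCap p a / 2 := by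
  induction U using Finset.induction_on with
  | empty => simp
  | insert p U hpU ih =>
    have hp := hU p (Finset.mem_insert_self p U)
    have ih' := ih fun r hr ↦ hU r (Finset.mem_insert_of_mem hr)
    rw [Finset.sum_insert hpU, Finset.union_insert]
    exact (abs_sub_le _ (semilocalGroundEnergy (S ∪ U) P a) _).trans
      (add_le_add (abs_semilocalGroundEnergy_insert_sub_le_half hp.1 hp.2 _ P) ih')

/-- **The handoff window case recovered**: for consecutive primes `q < q'` and every `b ≤ (log q')/2` (so `b < log q`; `b ≤ (log q)/2` gives `0`), the gain obeys
`|G_q(b; P)| ≤ placeCap(q, b)/2 = (log q)/√q = cap(q)` in EVERY sector `P` — the sector-by-sector form of `HandoffLoadCeiling`'s sandwich.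
[cite: ConnesConsani2023, §2.2–2.3 (the contribution of the new prime on its window); sharp cap: this track] -/
theorem abs_semilocalCumulant_handoff_le_cap_sector (h : ConsecutivePrimes q q') {b : ℝ}
    (hb : b ≤ Real.log q' / 2) (P : (ℝ → ℂ) → Prop) :
    |semilocalCumulant (Nat.primesBelow q) {q} P b| ≤ Real.log q / Real.sqrt q := by
  have hblt : b < Real.log q := hb.trans_lt h.log_half_lt_log
  rcases le_or_gt b (Real.log q / 2) with hle | hlt
  · rw [semilocalCumulant_handoff_eq_zero_of_le h.1 hle, abs_zero]
    exact (cap_pos h.1.two_le).le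
  · have hcap : placeCap q b = 2 * (Real.log q / Real.sqrt q) := placeCap_eq_atomWeight h.1 hlt.le hblt
    have := abs_semilocalCumulant_singleton_le_half h.1 hblt (Nat.primesBelow q) P
    rw [hcap] at this
    linarith

end Summit.RiemannHypothesis.RiemannHypothesis.Theorems.HandoffInteraction
end
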